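import Summits.KontsevichZagierPeriods.Zeta5Search.Barrier.ConeGammaTranslateGeneric

/-!
# ζ(5) search — BARRIER: THE DERIVATIVE OF THE TRANSLATE INTEGRAL IS LOCALLY CONSTANT ON THE GENERIC SET — `P` is AFFINE
# on every open convex set of generic translates (the cells of the translate arrangement)

HONEST FRAMING (cell `pub-zeta5`): systematic search; no irrationality claim unless kernel-certified. MODEL objects
under Brown–Zudilin's (28)+(30) accounting ([BZ22] = arXiv:2210.03391; (28) observed, not proved); nothing here is a
statement about `ζ(5)`, any `γ` of record, the cone's supremum (C2 OPEN) or any value at a named direction; no cell is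
enumerated; NO cancellation is quantified; S-E / (TD_A) stay CONJECTURED; records in print UNMOVED. Prover P2 g40 (SEQUEL to the
item «THE SIGNED JUMP MASSES», file (6); plan INBOX 2026-08-28 l.9836). Source: lead/lit g27 `SE-DESK-NOTE.md` §3(i) («a
certificate must exploit that `D` is piecewise LINEAR on the cells of an explicit hyperplane arrangement in `δ`»).

With `P = translateIntegral a T` (all 28 forms of `a` positive, `T > 0` a period) and the margin hypotheses `hsep` / `hend` of
`ConeGammaTranslateGradient` at a translate `δ` (file (4) `exists_margin_of_generic`: they hold off the walls `φ_kδ ∈ ℤ` and the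
resonances `N_{k'}φ_kδ − N_kφ_{k'}δ ∈ ℤ`, with an explicit `r`):
* `hasFDerivAt_translateIntegral_near` — on the ball `|φ_kΔ₀| ≤ r·h_k/8` around `δ`, `P` has at `δ + Δ₀` the SAME Fréchet derivative
  as at `δ` (file (4)'s one-chart lemma `translateIntegral_sub_eq_sum_jumpMass_near` + uniqueness of the derivative);
  **`fderiv_translateIntegral_eq_near`**, **`fderiv_translateIntegral_eventuallyEq`** (`∀ᶠ δ' in 𝓝 δ, fderiv ℝ P δ' = fderiv ℝ P δ`):
  THE DERIVATIVE OF `P` IS LOCALLY CONSTANT ON THE GENERIC SET;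
* **`fderiv_translateIntegral_const_on_convex`**, **`translateIntegral_affine_on_convex`** — for an OPEN CONVEX `C ⊆ ℝ⁸` in which
  EVERY translate has a margin: `fderiv ℝ P` is CONSTANT on `C` (a locally constant map on a preconnected subtype is constant) and
  **`P(δ₁) − P(δ₀) = fderiv ℝ P δ₀ (δ₁ − δ₀)` for all `δ₀, δ₁ ∈ C`** (`Convex.is_const_of_fderivWithin_eq_zero` on `P − fderiv ℝ P δ₀`):
  `P` IS AFFINE ON `C`. The open cells of the translate arrangement `{N_{k'}φ_k − N_kφ_{k'} ∈ ℤ} ∪ {φ_k ∈ ℤ}` are such sets, so this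
  is «`P` is affine on every open cell» — the statement a (TD_A) vertex-enumeration certificate would cite together with P2 g29's
  Lipschitz continuity of `P` (`abs_translateIntegral_sub_le`) for the closed cells.
NOT here (honest): the cells themselves (that they are convex and exhaust the generic set is inspection, not filed), their number,
any value of `P` or of its derivative anywhere; `Φ`, `γ`, C2, S-E's truth, `ζ(5)`.
-/

noncomputable section

open Set MeasureTheory Filter
open scoped Topology

namespace Summit.KontsevichZagierPeriods.Zeta5Search.Barrier.ConeGamma

/-! ### One derivative on the whole ball -/

/-- **ONE DERIVATIVE ON THE WHOLE BALL.** With a margin `r` at `δ`: for every `Δ₀` with `|φ_kΔ₀| ≤ r·h_k/8`, `P` is differentiable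
at `δ + Δ₀` AND at `δ`, with `fderiv ℝ P (δ + Δ₀) = fderiv ℝ P δ`. -/
theorem fderiv_translateIntegral_eq_near {a : Dir} (hpos : ∀ k, 0 < h28 a k) {T : ℝ} (hT : 0 < T)
    (hper : ∀ k : Fin 28, ∃ z : ℤ, T * h28 a k = z) {δ : Fin 8 → ℝ} {r : ℝ} (hr : 0 < r)
    (hsep : ∀ (k k' : Fin 28) (z z' : ℤ), (k ≠ k' ∨ z ≠ z') →
      r ≤ |((z : ℝ) - phiForm δ k) / h28 a k - ((z' : ℝ) - phiForm δ k') / h28 a k'|)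
    (hend : ∀ (k : Fin 28) (z : ℤ), r ≤ |((z : ℝ) - phiForm δ k) / h28 a k|)
    {Δ₀ : Fin 8 → ℝ} (hΔ₀ : ∀ k, |phiForm Δ₀ k| ≤ r * h28 a k / 8) :
    DifferentiableAt ℝ (translateIntegral a T) (δ + Δ₀) ∧
      fderiv ℝ (translateIntegral a T) (δ + Δ₀) = fderiv ℝ (translateIntegral a T) δ := by
  -- the common derivative as a continuous linear map
  set J : Fin 28 → ℝ := fun k => ((∑ z ∈ Finset.Ioc ⌊phiForm δ k⌋ (⌊phiForm δ k⌋ + ⌊T * h28 a k⌋),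
    (torusN ((((z : ℝ) - phiForm δ k) / h28 a k) • sParam a + δ) -
      torusN ((((z : ℝ) - phiForm δ k) / h28 a k - r / 2) • sParam a + δ)) : ℤ) : ℝ) with hJ
  let Lₗ : (Fin 8 → ℝ) →ₗ[ℝ] ℝ :=
    { toFun := fun Δ => ∑ k : Fin 28, phiForm Δ k / h28 a k * J k
      map_add' := fun Δ Δ' => by
        rw [← Finset.sum_add_distrib]
        exact Finset.sum_congr rfl fun k _ => by rw [phiForm_add]; ring
      map_smul' := fun c Δ => by
        rw [RingHom.id_apply, smul_eq_mul, Finset.mul_sum]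
        exact Finset.sum_congr rfl fun k _ => by rw [phiForm_smul]; ring }
  set L : (Fin 8 → ℝ) →L[ℝ] ℝ := LinearMap.toContinuousLinearMap Lₗ with hL
  have hLapply : ∀ Δ, L Δ = ∑ k : Fin 28, phiForm Δ k / h28 a k * J k := fun Δ => rfl
  obtain ⟨m, hm, hmle⟩ : ∃ m : ℝ, 0 < m ∧ ∀ k, m ≤ h28 a k := by
    obtain ⟨k₀, -, hk₀⟩ := Finset.exists_min_image Finset.univ (fun k => h28 a k) Finset.univ_nonempty
    exact ⟨h28 a k₀, hpos k₀, fun k => hk₀ k (Finset.mem_univ k)⟩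
  -- `P` has derivative `L` at every base point `δ + Δ₁` with `|φ_kΔ₁| ≤ r·h_k/8`
  have hderiv : ∀ Δ₁ : Fin 8 → ℝ, (∀ k, |phiForm Δ₁ k| ≤ r * h28 a k / 8) →
      HasFDerivAt (translateIntegral a T) L (δ + Δ₁) := by
    intro Δ₁ hΔ₁
    have haff : ∀ᶠ Δ in 𝓝 (0 : Fin 8 → ℝ),
        translateIntegral a T (δ + Δ₁ + Δ) - translateIntegral a T (δ + Δ₁) - L Δ = 0 := by
      rw [Metric.eventually_nhds_iff]
      refine ⟨r * m / 16, by positivity, fun Δ hΔ => ?_⟩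
      rw [dist_zero_right] at hΔ
      have hsmall : ∀ k, |phiForm Δ k| ≤ r * h28 a k / 8 := fun k =>
        calc |phiForm Δ k| ≤ 2 * ‖Δ‖ := abs_phiForm_le_two_mul_norm Δ k
          _ ≤ r * h28 a k / 8 := by nlinarith [hmle k, hΔ.le]
      rw [hLapply, translateIntegral_sub_eq_sum_jumpMass_near hpos hT hper hr hsep hend hΔ₁ hsmall, sub_self]
    rw [hasFDerivAt_iff_isLittleO_nhds_zero]
    exact (Asymptotics.isLittleO_zero (fun h : Fin 8 → ℝ => h) (𝓝 (0 : Fin 8 → ℝ))).congr'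
      (haff.mono fun Δ h => h.symm) Filter.EventuallyEq.rfl
  have h0 : ∀ k, |phiForm (0 : Fin 8 → ℝ) k| ≤ r * h28 a k / 8 := fun k => by
    have : phiForm (0 : Fin 8 → ℝ) k = 0 := by
      have h := phiForm_smul 0 (0 : Fin 8 → ℝ) k; rwa [zero_smul, zero_mul] at h
    rw [this, abs_zero]; have := hpos k; positivity
  have hd₀ := hderiv 0 h0
  rw [add_zero] at hd₀
  exact ⟨(hderiv Δ₀ hΔ₀).differentiableAt, by rw [(hderiv Δ₀ hΔ₀).fderiv, hd₀.fderiv]⟩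

/-- **THE DERIVATIVE IS LOCALLY CONSTANT**: with a margin at `δ`, `∀ᶠ δ' in 𝓝 δ, fderiv ℝ P δ' = fderiv ℝ P δ` (the sup-norm ball
`‖δ' − δ‖ ≤ r·x_min/16` lies inside `|φ_k(δ' − δ)| ≤ r·h_k/8`). -/
theorem fderiv_translateIntegral_eventuallyEq {a : Dir} (hpos : ∀ k, 0 < h28 a k) {T : ℝ} (hT : 0 < T)
    (hper : ∀ k : Fin 28, ∃ z : ℤ, T * h28 a k = z) {δ : Fin 8 → ℝ} {r : ℝ} (hr : 0 < r)
    (hsep : ∀ (k k' : Fin 28) (z z' : ℤ), (k ≠ k' ∨ z ≠ z') →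
      r ≤ |((z : ℝ) - phiForm δ k) / h28 a k - ((z' : ℝ) - phiForm δ k') / h28 a k'|)
    (hend : ∀ (k : Fin 28) (z : ℤ), r ≤ |((z : ℝ) - phiForm δ k) / h28 a k|) :
    ∀ᶠ δ' in 𝓝 δ, DifferentiableAt ℝ (translateIntegral a T) δ' ∧
      fderiv ℝ (translateIntegral a T) δ' = fderiv ℝ (translateIntegral a T) δ := by
  obtain ⟨m, hm, hmle⟩ : ∃ m : ℝ, 0 < m ∧ ∀ k, m ≤ h28 a k := by
    obtain ⟨k₀, -, hk₀⟩ := Finset.exists_min_image Finset.univ (fun k => h28 a k) Finset.univ_nonempty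
    exact ⟨h28 a k₀, hpos k₀, fun k => hk₀ k (Finset.mem_univ k)⟩
  rw [Metric.eventually_nhds_iff]
  refine ⟨r * m / 16, by positivity, fun δ' hδ' => ?_⟩
  rw [dist_eq_norm] at hδ'
  have hsmall : ∀ k, |phiForm (δ' - δ) k| ≤ r * h28 a k / 8 := fun k =>
    calc |phiForm (δ' - δ) k| ≤ 2 * ‖δ' - δ‖ := abs_phiForm_le_two_mul_norm _ k
      _ ≤ r * h28 a k / 8 := by nlinarith [hmle k, hδ'.le]
  have h := fderiv_translateIntegral_eq_near hpos hT hper hr hsep hend hsmall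
  rwa [add_sub_cancel] at h

/-! ### Affine on open convex sets of generic translates -/

/-- **THE DERIVATIVE IS CONSTANT ON EVERY OPEN CONVEX SET OF GENERIC TRANSLATES.** If `C` is open and convex and every `δ ∈ C` has
a margin (`hsep` ∧ `hend` for some `r > 0`), then `fderiv ℝ P δ₁ = fderiv ℝ P δ₀` for all `δ₀, δ₁ ∈ C`. -/
theorem fderiv_translateIntegral_const_on_convex {a : Dir} (hpos : ∀ k, 0 < h28 a k) {T : ℝ} (hT : 0 < T)
    (hper : ∀ k : Fin 28, ∃ z : ℤ, T * h28 a k = z) {C : Set (Fin 8 → ℝ)} (hC : Convex ℝ C)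
    (hgen : ∀ δ ∈ C, ∃ r : ℝ, 0 < r ∧
      (∀ (k k' : Fin 28) (z z' : ℤ), (k ≠ k' ∨ z ≠ z') →
        r ≤ |((z : ℝ) - phiForm δ k) / h28 a k - ((z' : ℝ) - phiForm δ k') / h28 a k'|) ∧
      (∀ (k : Fin 28) (z : ℤ), r ≤ |((z : ℝ) - phiForm δ k) / h28 a k|))
    {δ₀ δ₁ : Fin 8 → ℝ} (hδ₀ : δ₀ ∈ C) (hδ₁ : δ₁ ∈ C) :
    fderiv ℝ (translateIntegral a T) δ₁ = fderiv ℝ (translateIntegral a T) δ₀ := by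
  haveI : PreconnectedSpace C := Subtype.preconnectedSpace hC.isPreconnected
  -- the restriction of the derivative to `C` is locally constant
  have hloc : IsLocallyConstant fun x : C => fderiv ℝ (translateIntegral a T) (x : Fin 8 → ℝ) := by
    rw [IsLocallyConstant.iff_eventually_eq]
    intro x
    obtain ⟨r, hr, hsep, hend⟩ := hgen x x.2
    have h := fderiv_translateIntegral_eventuallyEq hpos hT hper hr hsep hend
    exact (eventually_nhds_subtype_iff C x fun z =>
      fderiv ℝ (translateIntegral a T) z = fderiv ℝ (translateIntegral a T) (x : Fin 8 → ℝ)).mpr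
      (eventually_nhdsWithin_of_eventually_nhds (h.mono fun δ' hδ' => hδ'.2))
  exact hloc.apply_eq_of_preconnectedSpace ⟨δ₁, hδ₁⟩ ⟨δ₀, hδ₀⟩

/-- **`P` IS AFFINE ON EVERY OPEN CONVEX SET OF GENERIC TRANSLATES.** If `C ⊆ ℝ⁸` is open and convex and every translate in `C`
has a margin, then for all `δ₀, δ₁ ∈ C`: `P(δ₁) − P(δ₀) = fderiv ℝ P δ₀ (δ₁ − δ₀)` — one affine function on the whole of `C`
(the open cells of the translate arrangement are such sets: «`P` is affine on every open cell»). -/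
theorem translateIntegral_affine_on_convex {a : Dir} (hpos : ∀ k, 0 < h28 a k) {T : ℝ} (hT : 0 < T)
    (hper : ∀ k : Fin 28, ∃ z : ℤ, T * h28 a k = z) {C : Set (Fin 8 → ℝ)} (hCo : IsOpen C) (hC : Convex ℝ C)
    (hgen : ∀ δ ∈ C, ∃ r : ℝ, 0 < r ∧
      (∀ (k k' : Fin 28) (z z' : ℤ), (k ≠ k' ∨ z ≠ z') →
        r ≤ |((z : ℝ) - phiForm δ k) / h28 a k - ((z' : ℝ) - phiForm δ k') / h28 a k'|) ∧
      (∀ (k : Fin 28) (z : ℤ), r ≤ |((z : ℝ) - phiForm δ k) / h28 a k|))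
    {δ₀ δ₁ : Fin 8 → ℝ} (hδ₀ : δ₀ ∈ C) (hδ₁ : δ₁ ∈ C) :
    translateIntegral a T δ₁ - translateIntegral a T δ₀ = fderiv ℝ (translateIntegral a T) δ₀ (δ₁ - δ₀) := by
  set L := fderiv ℝ (translateIntegral a T) δ₀ with hL
  -- differentiability on `C`
  have hdiff : ∀ δ ∈ C, DifferentiableAt ℝ (translateIntegral a T) δ := by
    intro δ hδ
    obtain ⟨r, hr, hsep, hend⟩ := hgen δ hδ
    exact (differentiableAt_translateIntegral hpos hT hper hr hsep hend).1
  -- `Q = P − L` has zero derivative within `C`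
  set Q : (Fin 8 → ℝ) → ℝ := fun δ => translateIntegral a T δ - L δ with hQ
  have hQd : DifferentiableOn ℝ Q C := fun δ hδ =>
    ((hdiff δ hδ).sub L.differentiableAt).differentiableWithinAt
  have hQ0 : ∀ δ ∈ C, fderivWithin ℝ Q C δ = 0 := by
    intro δ hδ
    rw [fderivWithin_of_isOpen hCo hδ, hQ, fderiv_fun_sub (hdiff δ hδ) L.differentiableAt, ContinuousLinearMap.fderiv,
      fderiv_translateIntegral_const_on_convex hpos hT hper hC hgen hδ₀ hδ, sub_self]
  have h := hC.is_const_of_fderivWithin_eq_zero hQd hQ0 hδ₀ hδ₁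
  simp only [hQ] at h
  have e : L (δ₁ - δ₀) = L δ₁ - L δ₀ := map_sub L δ₁ δ₀
  rw [e]; linarith

end Summit.KontsevichZagierPeriods.Zeta5Search.Barrier.ConeGamma

end
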